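import Literature.Computability.AlgebraicComplexity.GrenetEquivariant
import Literature.Computability.AlgebraicComplexity.LandsbergRessayre
import Literature.Computability.AlgebraicComplexity.LRPencilOfMatrix
import Literature.Computability.AlgebraicComplexity.DetReprEquivalent

/-!
# Crux `ProjectionStability.OptStep` (stmt-ValiantsHypothesis-17835), line `Sketch` —
# stub `stub_grenet_leftEquivariant`: Grenet's matrix respects the LEFT monomial symmetries

Route `ValiantsHypothesis/ProjectionStability`, crux item `stmt-ValiantsHypothesis-17835`, line
`Sketch`, stub S3.

**Statement.** For `n ≠ 0`, `2ⁿ = N + 1` and any enumeration `e : Finset (Fin n) ≃ Fin (N + 1)`,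
Grenet's `N × N` affine matrix `Grenet.repr ℂ n e` (determinant `per_n`) is an EXACTLY-lifted
`leftMonomialSubst ℂ n`-equivariant determinantal representation of `per_n`
(Landsberg–Ressayre 2017, §2.2: "Grenet's expressions respect about half the symmetries"; this is
the upper-bound half of `edc_{N(T^{GL(E)})}(per_m) = 2^m - 1`, LR17 Thm. 2.8).

**Proof.** `leftMonomialSubst k m` is the image of `monomialSubgroup k m` under the monoid hom
`g ↦ g ⊗ 1`, hence it lies in the subgroup generated by the `P_π ⊗ 1` (permutation matrices) and
the `diag d ⊗ 1` (invertible diagonals) (`leftMonomialSubst_le_closure`); exact lifts compose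
(`IsEquivariantDetRepr.of_generators`) and equivariance is antitone in the group
(`IsEquivariantDetRepr.anti`), so it suffices to lift these generators.
* `diag d ⊗ 1 = diagonal (fun p => d p.1 * 1)` is the torus case `e = 1` of
  `Grenet.isEquivariantDetRepr_repr` (diagonal vertex scalings).
* `P_π ⊗ 1` substitutes `X (j, c) ↦ X (π⁻¹ j, c)` (`linSubst_permKron_X`); on the weighted
  adjacency matrix of Grenet's branching program (arc `S → insert j S` of weight `X (j, |S|)`)
  this is the vertex relabelling `S ↦ π⁻¹ S` (`linSubst_permKron_adj`:
  `j ∉ S ↔ π⁻¹ j ∉ π⁻¹ S`, `π⁻¹ (insert j S) = insert (π⁻¹ j) (π⁻¹ S)`, `|π⁻¹ S| = |S|`), i.e.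
  `(1 - adj)(γ · x) = (1 - adj).submatrix ρ ρ`; the relabelling fixes `∅` and `univ`, so it
  permutes the surviving rows (`≠ univ`) and columns (`≠ ∅`) of the minor
  (`exists_perm_succAbove`), and a row/column permutation of the minor is the two-sided product
  with permutation matrices (`submatrix_eq_permMatrix_mul_mul`), which are constant units.
-/

open MvPolynomial Matrix Finset
open scoped Kronecker
open Literature.Computability.AlgebraicComplexity

-- the mandated summit-side namespace repeats a component by design (single-problem summit)
set_option linter.dupNamespace false

namespace Summit.ValiantsHypothesis.ValiantsHypothesis.Theorems.ProjectionStabilityOptStep.GrenetLeftEquivariant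

noncomputable section

/-! ### The left monomial substitutions are generated by `P_π ⊗ 1` and `diag d ⊗ 1` -/

section Subgroups

variable (k : Type*) [Field k] (m : ℕ)

/-- **`leftMonomialSubst` lies in the subgroup generated by the substitutions `P_π ⊗ 1`
(`π ∈ 𝔖_m`) and `diag d ⊗ 1`** (LR17 §2.1: `N(T^{GL(E)}) = T^{GL(E)} ⋊ 𝔖_m`): push the
generators of `monomialSubgroup` through the monoid hom `g ↦ g ⊗ 1` (`Subgroup.mem_comap`).
[folklore] -/
theorem leftMonomialSubst_le_closure :
    leftMonomialSubst k m ≤ Subgroup.closure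
      ({γ : GL (Fin m × Fin m) k | ∃ π : Equiv.Perm (Fin m),
          (γ : Matrix (Fin m × Fin m) (Fin m × Fin m) k) =
            π.permMatrix k ⊗ₖ (1 : Matrix (Fin m) (Fin m) k)} ∪
        {γ | ∃ d : Fin m → k,
          (γ : Matrix (Fin m × Fin m) (Fin m × Fin m) k) =
            Matrix.diagonal d ⊗ₖ (1 : Matrix (Fin m) (Fin m) k)}) := by
  -- the left action `g ↦ g ⊗ 1 ∈ GL(m²)` as a monoid hom `GL_m → GL_{m²}`
  let K : GL (Fin m) k →* GL (Fin m × Fin m) k :=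
    { toFun := fun g => Matrix.GeneralLinearGroup.kronecker g 1
      map_one' := Units.ext (by
        show ((1 : GL (Fin m) k) : Matrix (Fin m) (Fin m) k) ⊗ₖ
            ((1 : GL (Fin m) k) : Matrix (Fin m) (Fin m) k) = 1
        rw [Units.val_one, Matrix.one_kronecker_one])
      map_mul' := fun x y => Units.ext (by
        show ((x * y : GL (Fin m) k) : Matrix (Fin m) (Fin m) k) ⊗ₖ
            ((1 : GL (Fin m) k) : Matrix (Fin m) (Fin m) k) =
          ((x : Matrix (Fin m) (Fin m) k) ⊗ₖ ((1 : GL (Fin m) k) : Matrix (Fin m) (Fin m) k)) *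
            ((y : Matrix (Fin m) (Fin m) k) ⊗ₖ ((1 : GL (Fin m) k) : Matrix (Fin m) (Fin m) k))
        rw [← Matrix.mul_kronecker_mul, Units.val_mul, Units.val_one, Matrix.mul_one]) }
  have hK : ∀ g : GL (Fin m) k,
      ((K g : GL (Fin m × Fin m) k) : Matrix (Fin m × Fin m) (Fin m × Fin m) k) =
        (g : Matrix (Fin m) (Fin m) k) ⊗ₖ 1 := fun _ => rfl
  rw [leftMonomialSubst, Subgroup.closure_le]
  rintro γ ⟨g, hg, hγ⟩
  have hγK : γ = K g := Units.ext (by rw [hK, hγ])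
  subst hγK
  rw [SetLike.mem_coe, ← Subgroup.mem_comap]
  unfold monomialSubgroup at hg
  refine (Subgroup.closure_le _).mpr ?_ hg
  rintro g' (⟨π, hπ⟩ | ⟨d, hd⟩)
  · rw [SetLike.mem_coe, Subgroup.mem_comap]
    exact Subgroup.subset_closure (Or.inl ⟨π, by rw [hK, hπ]⟩)
  · rw [SetLike.mem_coe, Subgroup.mem_comap]
    exact Subgroup.subset_closure (Or.inr ⟨d, by rw [hK, hd]⟩)

end Subgroups

/-! ### The substitution `P_π ⊗ 1` relabels the vertices of Grenet's branching program -/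

section Perm

variable {k : Type*} [Field k] {n : ℕ}

/-- `P_π ⊗ 1` is the permutation matrix of `π × 1` on the index pairs. [folklore] -/
theorem permMatrix_kronecker_one (π : Equiv.Perm (Fin n)) :
    π.permMatrix k ⊗ₖ (1 : Matrix (Fin n) (Fin n) k) =
      Equiv.Perm.permMatrix k (Equiv.prodCongr π (Equiv.refl (Fin n))) := by
  refine Matrix.ext fun p q => ?_
  obtain ⟨a, b⟩ := p
  obtain ⟨c, d⟩ := q
  simp only [Matrix.kronecker_apply, PEquiv.toMatrix_apply, Equiv.toPEquiv_apply, Option.mem_def,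
    Option.some.injEq, Matrix.one_apply, Equiv.prodCongr_apply, Prod.map_apply, Equiv.coe_refl,
    id_eq, Prod.mk.injEq]
  by_cases h1 : π a = c <;> by_cases h2 : b = d <;> simp [h1, h2]

/-- With the tree's convention `linSubst A (X i) = ∑ j, A j i • X j`, the substitution `P_π ⊗ 1`
renames the FIRST index: `X (j, c) ↦ X (π⁻¹ j, c)`. [folklore] -/
theorem linSubst_permKron_X (π : Equiv.Perm (Fin n)) (p : Fin n × Fin n) :
    linSubst (Fin n × Fin n) k (π.permMatrix k ⊗ₖ (1 : Matrix (Fin n) (Fin n) k)) (X p) =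
      X (π.symm p.1, p.2) := by
  rw [permMatrix_kronecker_one, linSubst_permMatrix, rename_X]
  rfl

/-- On Grenet's weights: `wt j c ↦ wt (π⁻¹ j) c`. [folklore] -/
theorem linSubst_permKron_wt (π : Equiv.Perm (Fin n)) (j : Fin n) (c : ℕ) :
    linSubst (Fin n × Fin n) k (π.permMatrix k ⊗ₖ (1 : Matrix (Fin n) (Fin n) k)) (Grenet.wt k n j c) =
      Grenet.wt k n (π.symm j) c := by
  unfold Grenet.wt
  split_ifs with h
  · rw [linSubst_permKron_X]
  · exact map_zero _

/-- **`P_π ⊗ 1` acts on the adjacency matrix by the vertex relabelling `S ↦ π⁻¹ S`**: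
`adj(γ · x) S T = adj (π⁻¹ S) (π⁻¹ T)` (`j ∉ S ↔ π⁻¹ j ∉ π⁻¹ S`,
`π⁻¹ (insert j S) = insert (π⁻¹ j) (π⁻¹ S)`, `|π⁻¹ S| = |S|`). (LR17 §2.2) [folklore] -/
theorem linSubst_permKron_adj (π : Equiv.Perm (Fin n)) (S T : Finset (Fin n)) :
    linSubst (Fin n × Fin n) k (π.permMatrix k ⊗ₖ (1 : Matrix (Fin n) (Fin n) k)) (Grenet.adj k n S T) =
      Grenet.adj k n (S.map π.symm.toEmbedding) (T.map π.symm.toEmbedding) := by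
  rw [Grenet.adj_apply, Grenet.adj_apply, map_sum]
  refine Fintype.sum_equiv π.symm _ _ fun j => ?_
  have hmem : π.symm j ∈ S.map π.symm.toEmbedding ↔ j ∈ S := Finset.mem_map' _
  have hins : (insert j S).map π.symm.toEmbedding = insert (π.symm j) (S.map π.symm.toEmbedding) :=
    Finset.map_insert _ _ _
  have hiff : (π.symm j ∉ S.map π.symm.toEmbedding ∧
      T.map π.symm.toEmbedding = insert (π.symm j) (S.map π.symm.toEmbedding)) ↔
        (j ∉ S ∧ T = insert j S) := by
    rw [hmem, ← hins, Finset.map_inj]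
  by_cases h : j ∉ S ∧ T = insert j S
  · rw [if_pos h, if_pos (hiff.mpr h), linSubst_permKron_wt, Finset.card_map]
  · rw [if_neg h, if_neg (mt hiff.mp h), map_zero]

/-- Matrix form: `(1 - adj)(γ · x) = (1 - adj).submatrix ρ ρ` with `ρ S = π⁻¹ S`. [folklore] -/
theorem map_linSubst_permKron_one_sub_adj (π : Equiv.Perm (Fin n)) :
    (1 - Grenet.adj k n).map
        (linSubst (Fin n × Fin n) k (π.permMatrix k ⊗ₖ (1 : Matrix (Fin n) (Fin n) k))) =
      (1 - Grenet.adj k n).submatrix (fun S => S.map π.symm.toEmbedding)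
        (fun S => S.map π.symm.toEmbedding) := by
  refine Matrix.ext fun S T => ?_
  rw [Matrix.map_apply, Matrix.submatrix_apply, Matrix.sub_apply, Matrix.sub_apply, map_sub,
    linSubst_permKron_adj, Matrix.one_apply, Matrix.one_apply]
  by_cases hST : S = T
  · rw [if_pos hST, if_pos (by rw [hST]), map_one]
  · rw [if_neg hST, if_neg (fun H => hST (Finset.map_injective _ H)), map_zero]

/-- The relabelling `S ↦ τ S` fixes a "hole" `h ∈ {∅, univ}`, hence permutes the indices of the
minor deleting `h`: there is `α ∈ 𝔖_N` with `r (α i) = τ (r i)` for the enumeration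
`r i = e⁻¹ ((e h).succAbove i)` of `{S | S ≠ h}`. [folklore] -/
theorem exists_perm_succAbove {N : ℕ} (e : Finset (Fin n) ≃ Fin (N + 1)) (τ : Equiv.Perm (Fin n))
    (h : Finset (Fin n)) (hh : h.map τ.toEmbedding = h) :
    ∃ α : Equiv.Perm (Fin N), ∀ i,
      e.symm ((e h).succAbove (α i)) = (e.symm ((e h).succAbove i)).map τ.toEmbedding := by
  have key : ∀ i, ∃ i',
      e.symm ((e h).succAbove i') = (e.symm ((e h).succAbove i)).map τ.toEmbedding := by
    intro i
    have hne : (e.symm ((e h).succAbove i)).map τ.toEmbedding ≠ h := by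
      intro H
      have H' : e.symm ((e h).succAbove i) = h := by
        apply Finset.map_injective τ.toEmbedding
        rw [H, hh]
      exact Fin.succAbove_ne (e h) i (e.symm_apply_eq.mp H')
    obtain ⟨z, hz⟩ := Fin.exists_succAbove_eq (e.injective.ne hne)
    exact ⟨z, by rw [hz, e.symm_apply_apply]⟩
  choose a ha using key
  have hinj : Function.Injective a := by
    intro i j hij
    have H : (e.symm ((e h).succAbove i)).map τ.toEmbedding =
        (e.symm ((e h).succAbove j)).map τ.toEmbedding := by
      rw [← ha i, ← ha j, hij]
    exact Fin.succAbove_right_injective (e.symm.injective (Finset.map_injective _ H))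
  exact ⟨Equiv.ofBijective a (Finite.injective_iff_bijective.mp hinj), ha⟩

/-- A row/column permutation of a square matrix is the two-sided product with permutation
matrices: `M.submatrix α β = P_α · M · P_{β⁻¹}`. [folklore] -/
theorem submatrix_eq_permMatrix_mul_mul {R : Type*} [Semiring R] {N : ℕ} (M : Matrix (Fin N) (Fin N) R)
    (α β : Equiv.Perm (Fin N)) :
    M.submatrix α β = α.permMatrix R * M * β⁻¹.permMatrix R := by
  rw [PEquiv.toMatrix_toPEquiv_mul, PEquiv.mul_toMatrix_toPEquiv, Matrix.submatrix_submatrix,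
    Function.comp_id, Function.id_comp, Equiv.Perm.inv_def, Equiv.symm_symm]

/-- Permutation matrices are constant: `(P_σ).map C = P_σ`. [folklore] -/
theorem permMatrix_map_C {ι : Type*} [DecidableEq ι] (σ : Equiv.Perm ι) :
    (σ.permMatrix k).map (C : k →+* MvPolynomial (Fin n × Fin n) k) =
      σ.permMatrix (MvPolynomial (Fin n × Fin n) k) := by
  refine Matrix.ext fun i j => ?_
  simp only [Matrix.map_apply, PEquiv.toMatrix_apply]
  split_ifs
  · exact map_one _
  · exact map_zero _

/-- **The substitution `P_π ⊗ 1` on Grenet's matrix is a row/column permutation**, realised by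
constant permutation matrices: `M(γ · x) = P_α · M(x) · P_β⁻¹` (LR17 §2.2: Grenet's expressions
respect the left symmetries `𝔖_m ⊆ N(T^{GL(E)})`). [folklore] -/
theorem linSubstEntries_permKron_repr {N : ℕ} (e : Finset (Fin n) ≃ Fin (N + 1))
    (π : Equiv.Perm (Fin n)) (γ : GL (Fin n × Fin n) k)
    (hγ : (γ : Matrix (Fin n × Fin n) (Fin n × Fin n) k) = π.permMatrix k ⊗ₖ 1) :
    ∃ α β : Equiv.Perm (Fin N), Matrix.linSubstEntries γ (Grenet.repr k n e) =
      ((LRPencil.permUnit k α : GL (Fin N) k) : Matrix (Fin N) (Fin N) k).map C * Grenet.repr k n e *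
        (((LRPencil.permUnit k β)⁻¹ : GL (Fin N) k) : Matrix (Fin N) (Fin N) k).map C := by
  obtain ⟨α, hα⟩ := exists_perm_succAbove e π.symm univ (Finset.map_univ_equiv _)
  obtain ⟨β, hβ⟩ := exists_perm_succAbove e π.symm ∅ (Finset.map_empty _)
  refine ⟨α, β, ?_⟩
  have h1 : ((LRPencil.permUnit k α : GL (Fin N) k) : Matrix (Fin N) (Fin N) k) = α.permMatrix k := rfl
  have h2 : (((LRPencil.permUnit k β)⁻¹ : GL (Fin N) k) : Matrix (Fin N) (Fin N) k) =
      β⁻¹.permMatrix k := rfl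
  rw [h1, h2, permMatrix_map_C, permMatrix_map_C, ← submatrix_eq_permMatrix_mul_mul]
  unfold Matrix.linSubstEntries Grenet.repr
  rw [hγ]
  set F := linSubst (Fin n × Fin n) k (π.permMatrix k ⊗ₖ (1 : Matrix (Fin n) (Fin n) k)) with hF
  have hsign : F ((-1 : MvPolynomial (Fin n × Fin n) k) ^ ((e univ : ℕ) + (e ∅ : ℕ))) =
      (-1 : MvPolynomial (Fin n × Fin n) k) ^ ((e univ : ℕ) + (e ∅ : ℕ)) := by
    rw [map_pow, map_neg, map_one]
  rw [Matrix.map_smul' _ _ _ (map_mul F), hsign, ← Matrix.submatrix_map, ← Matrix.submatrix_map, hF,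
    map_linSubst_permKron_one_sub_adj]
  refine Matrix.ext fun i j => ?_
  simp only [Matrix.smul_apply, Matrix.submatrix_apply]
  rw [hα i, hβ j]

end Perm

/-! ### Assembly -/

section Main

variable {k : Type*} [Field k] {n : ℕ}

/-- **Grenet's representation respects the left monomial symmetries, with exact lifts**
(Landsberg–Ressayre 2017, §2.2; the upper-bound half of Thm. 2.8), over any field: every
`γ ∈ leftMonomialSubst k n` lifts to constant `(g, h) ∈ GL_N × GL_N` with
`M(γ · x) = g · M(x) · h⁻¹` — permutation matrices for `P_π ⊗ 1`, diagonal vertex scalings for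
`diag d ⊗ 1`, and products of those in general. [folklore] -/
theorem isEquivariantDetRepr_leftMonomialSubst_repr (hn : n ≠ 0) {N : ℕ} (hN : 2 ^ n = N + 1)
    (e : Finset (Fin n) ≃ Fin (N + 1)) :
    IsEquivariantDetRepr (leftMonomialSubst k n) (perPoly (Fin n) k) (Grenet.repr k n e) := by
  refine IsEquivariantDetRepr.anti ?_ (leftMonomialSubst_le_closure k n)
  refine IsEquivariantDetRepr.of_generators (Grenet.isAffineDetRepr_repr k n hn hN e) ?_
  rintro γ (⟨π, hπ⟩ | ⟨d, hd⟩)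
  · obtain ⟨α, β, h⟩ := linSubstEntries_permKron_repr e π γ hπ
    exact ⟨LRPencil.permUnit k α, LRPencil.permUnit k β, h⟩
  · refine (Grenet.isEquivariantDetRepr_repr hn hN e).2 _
      (Subgroup.subset_closure ⟨d, fun _ => 1, ?_⟩)
    rw [hd, ← Matrix.diagonal_one, Matrix.diagonal_kronecker_diagonal]

end Main

/-- **S3 — Grenet's matrix is `leftMonomialSubst`-equivariant** (Landsberg–Ressayre 2017 §2.2:
"Grenet's expressions respect about half the symmetries"; the upper-bound half of
`edc = 2^m − 1`, Thm. 2.8): every left monomial symmetry `x ↦ g · x` of `M_n` (`g` a product of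
permutation and invertible diagonal matrices, acting on the FIRST index of the variables
`X (j, c)` — in Grenet's branching program the arc `S → S ∪ {j}` at level `c = |S|` carries
`X (j, c)`), lifts exactly to `GL_N × GL_N` on `Grenet.repr ℂ n e`. [folklore] -/
theorem stub_grenet_leftEquivariant :
    ∀ (n : ℕ), n ≠ 0 → ∀ (N : ℕ) (hN : 2 ^ n = N + 1) (e : Finset (Fin n) ≃ Fin (N + 1)),
      IsEquivariantDetRepr (leftMonomialSubst ℂ n) (perPoly (Fin n) ℂ) (Grenet.repr ℂ n e) :=
  fun _ hn _ hN e => isEquivariantDetRepr_leftMonomialSubst_repr hn hN e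

end

end Summit.ValiantsHypothesis.ValiantsHypothesis.Theorems.ProjectionStabilityOptStep.GrenetLeftEquivariant
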